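import Literature.NumberTheory.QuadraticForms.IsotropicRankFive
import Literature.NumberTheory.QuadraticForms.HilbertSymbolLocalQuinary
import HarnessLib

/-!
# The completions `K_v` have a regular Hilbert symbol; forms of rank `≥ 5` over `K_v`

Topic `NumberTheory/QuadraticForms`; namespace `Literature.NumberTheory.QuadraticForms`. Everything
here is proved. The model of the hypothesis structure `IsRegularHilbertField`
(`HilbertSymbolRegular.lean`) promised there: for a number field `K` and a finite place `v`, the
completion `K_v = v.adicCompletion K` has a bilinear, nondegenerate Hilbert symbol
(`HilbertSymbolBilinear.lean`, O'Meara 63:13a; `HilbertSymbolLocalRepresentation.lean`, O'Meara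
63:13 — Serre, *A Course in Arithmetic*, Ch. III §1.2 Thm 2 for `K = ℚ`), and at least four
square classes (O'Meara 63:9; `exists_not_isSquare_hilbertSymbol_eq_one`,
`HilbertSymbolLocalQuinary.lean`). Consequently the abstract theorems of `IsotropicRankFive.lean`
apply to `K_v`:

* `isRegularHilbertField_adicCompletion` — `IsRegularHilbertField (v.adicCompletion K)`;
* `exists_three_nonsquares_adicCompletion` — three elements `b, c, bc` of `K_v` none of which is
  a square;
* `exists_isotropic_of_five_le_adicCompletion` — **Thm 6 (iv) for arbitrary nondegenerate
  symmetric matrices over `K_v`**: every symmetric `A ∈ Mₙ(K_v)`, `n ≥ 5`, `det A ≠ 0`, has a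
  non-trivial zero (the diagonal quinary case is `exists_quinary_zero` of
  `HilbertSymbolLocalQuinary.lean`);
* `exists_isotropic_of_rank_four_adicCompletion` — **Thm 6 (iii), `d ≠ 1`** over `K_v`: a
  diagonal quaternary form whose discriminant is not a square has a non-trivial zero.

## References

* J.-P. Serre, *A Course in Arithmetic*, GTM 7, Springer 1973, Ch. III §1.2 Thm 2; Ch. IV §2.2
  Thm 6 (iii), (iv) (PDF pp. 20, 35–37). [Serre1973]
* O. T. O'Meara, *Introduction to quadratic forms* (1963), §63 (63:9, 63:13, 63:13a).
-/

noncomputable section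

namespace Literature.NumberTheory.QuadraticForms

open IsDedekindDomain NumberField

variable (K : Type) [Field K] [NumberField K] (v : HeightOneSpectrum (𝓞 K))

/-- **`K_v` has a bilinear nondegenerate Hilbert symbol** (Serre, Ch. III §1.2 Thm 2 for `ℚ_p`;
O'Meara 63:13, 63:13a for the completions of a number field): the structure
`IsRegularHilbertField (v.adicCompletion K)` from `neZero_two_adicCompletion`,
`hilbertSymbol_adicCompletion_mul_left` and `exists_hilbertSymbol_eq_neg_one_left`.
[cite: Serre1973, Ch. III §1.2 Thm 2] -/
theorem isRegularHilbertField_adicCompletion : IsRegularHilbertField (v.adicCompletion K) where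
  two_ne_zero := (neZero_two_adicCompletion K v).out
  mul_left := fun _ _ _ ha hb hc => hilbertSymbol_adicCompletion_mul_left K v ha hb hc
  exists_eq_neg_one := fun _ hb hs => exists_hilbertSymbol_eq_neg_one_left K v hb hs

/-- **Three non-squares `b, c, bc` in `K_v`** (at least four square classes, O'Meara 63:9): take
a non-square `k` (`exists_not_isSquare_hilbertSymbol_eq_one` with `u = 1`), then `a` with
`(a, k)_v = -1` (nondegeneracy) and a non-square `k'` with `(k', a)_v = 1`; since
`(k, a)_v ≠ (k', a)_v`, `k k'` is not a square either. [cite: Omeara1963, §63A Prop. 63:9] -/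
theorem exists_three_nonsquares_adicCompletion :
    ∃ b c : v.adicCompletion K, ¬ IsSquare b ∧ ¬ IsSquare c ∧ ¬ IsSquare (b * c) := by
  obtain ⟨k, hk0, hks, -⟩ := exists_not_isSquare_hilbertSymbol_eq_one K v
    (u := (1 : v.adicCompletion K)) one_ne_zero
  obtain ⟨a, ha0, hak⟩ := exists_hilbertSymbol_eq_neg_one_left K v hk0 hks
  obtain ⟨k', hk'0, hk's, hk'a⟩ := exists_not_isSquare_hilbertSymbol_eq_one K v (u := a) ha0
  refine ⟨k, k', hks, hk's, fun ⟨s, hs⟩ => ?_⟩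
  -- `k k' = s²` would give `(k', a) = (k, a)`
  have hs0 : s ≠ 0 := by
    rintro rfl
    exact mul_ne_zero hk0 hk'0 (by rw [hs, mul_zero])
  have hk' : k' = k * (s / k) ^ 2 := by
    field_simp
    linear_combination hs
  rw [hk', hilbertSymbol_mul_sq_left _ _ (div_ne_zero hs0 hk0), hilbertSymbol_comm, hak] at hk'a
  norm_num at hk'a

/-- **Every nondegenerate quadratic form of rank `≥ 5` over `K_v` represents zero** (Serre,
*A Course in Arithmetic*, Ch. IV §2.2 Thm 6 (iv), for arbitrary symmetric matrices over the
completion of a number field at a finite place): `exists_isotropic_of_five_le` for the regular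
Hilbert field `K_v`. [cite: Serre1973, Ch. IV §2.2 Thm 6 (iv)] -/
theorem exists_isotropic_of_five_le_adicCompletion {n : ℕ}
    (A : Matrix (Fin n) (Fin n) (v.adicCompletion K)) (hn : 5 ≤ n) (hA : A.IsSymm)
    (hdet : A.det ≠ 0) : ∃ x : Fin n → v.adicCompletion K, x ≠ 0 ∧ Matrix.toBilin' A x x = 0 :=
  exists_isotropic_of_five_le (isRegularHilbertField_adicCompletion K v)
    (exists_three_nonsquares_adicCompletion K v) A hn hA hdet

/-- **Rank `4`, `d ≠ 1`, over `K_v`** (Serre, Ch. IV §2.2 Thm 6 (iii)): a diagonal quaternary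
form `∑ bᵢXᵢ²` over `K_v` with `bᵢ ≠ 0` and `b₀b₁b₂b₃` not a square represents zero.
[cite: Serre1973, Ch. IV §2.2 Thm 6 (iii)] -/
theorem exists_isotropic_of_rank_four_adicCompletion {b : Fin 4 → v.adicCompletion K}
    (hb : ∀ i, b i ≠ 0) (hd : ¬ IsSquare (b 0 * b 1 * b 2 * b 3)) :
    ∃ x : Fin 4 → v.adicCompletion K, x ≠ 0 ∧ ∑ i, b i * x i ^ 2 = 0 :=
  exists_isotropic_of_rank_four (isRegularHilbertField_adicCompletion K v) hb hd

end Literature.NumberTheory.QuadraticForms
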